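import Summits.RiemannHypothesis.RiemannHypothesis.Theorems.PfPersistenceRatioRejection
import HarnessLib

/-!
# PF persistence — DIAL ISOLATION OF `ζ` IN THE `∀`-WINDOW GAUGE-RATIO CLASS: along a window sequence carrying
the cluster binders, NO amplitude of the `q`-dial inhabits
(pub-rhpf barrier-prover gen 5, file 2; CASE-DAG leaf G1.21b / §6 PINCER `(Z)`-cell, AS-WORDED side)

**HONEST FRAMING. This is a long-odds MECHANISM / RIGIDITY campaign; no RH claims.** RH-free linear algebra and
dial-space bookkeeping only; `ζ`'s Weil positivity is never assumed or concluded. The cluster binders below are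
HYPOTHESES (per-window, sign-blind, engine-certifiable numbers), packaged as a structure so that the AS-WORDED
statement can be read off; nothing here asserts that `ζ` satisfies them.

## What is proved

File 1 (`PfPersistenceRatioRejection`) rejects ONE dial at ONE window from binders stated for that dial's push.
Here the binders are stated ONCE PER WINDOW in unit-amplitude form — `ζ`'s 2-cluster plane `{x, y}` of height
`η₂ ≥ 0`, the most negative pattern value `−c′` (`c′ ≥ 0`) of `Θ_q` on that plane, and one vector `v₀` of
`ζ`-height `η` with pattern value `≥ ρ > 0` — and the amplitude is quantified:

* §1 `dial_not_mem_gaugeRatioAt_of_amplitude` — every UP-dial amplitude `t = 2(K − 1)w(q) > 0` with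
  `t · (ρ(1 − τ) − τc′) > τη₂ + η(1 − τ)` is rejected by the gauge-ratio conjunct at that window; the admissible
  ("arrival") amplitudes at the window are an interval `(0, t₀(w)]` with
  `t₀(w) = (τη₂ + η(1 − τ)) / (ρ(1 − τ) − τc′)` whenever `τc′ < ρ(1 − τ)`. `…_of_amplitude_neg` is the DOWN-dial
  mirror (pattern value `≤ −ρ` on `v₀`, cap `vᵀΘ_q v ≤ c′` on the plane).
* §2 `ClusterBinders q W ρ C` — the binders ALONG A WINDOW SEQUENCE `W : ℕ → Window` reaching `q`: planes and
  vectors as above at every `W n` with a uniform pattern floor `ρ` and cap `C`, and heights `η₂ n, η n` that become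
  arbitrarily small (`∀ δ > 0, ∃ n, η₂ n ≤ δ ∧ η n ≤ δ`; DATA: `ζ`'s even 2-cluster, PF-N2, and convergence of the
  cluster profiles, PF-C7 — not claimed here).
* §2 `upDial_not_mem_gaugeRatioClass` — **DIAL ISOLATION, AS WORDED:** under `ClusterBinders q W ρ C` with
  `τC < ρ(1 − τ)` (`0 ≤ τ < 1`), NO up-dial of `ζ` at `q` of ANY amplitude `t > 0` lies in the `∀`-window class
  `GaugeRatioClass τ = ⋂_w {d | |ε₁(d; w)| ≤ τ·(ε₂ − ε₁)(d; w)}`: the floor `t₀(W n) → 0`, so every fixed amplitude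
  is rejected at some deep window. `downDial_not_mem_gaugeRatioClass` is the mirror under `ClusterBindersNeg`.
* §3 `subset_gaugeRatioClass_disjoint_upDials` — for the carver: a class inside `GaugeRatioClass τ` contains no
  up-dial at a binder-ready `q`; its separating power at such `q` owes nothing to the W2 door (small dials in the
  class) and everything to `ζ`'s own `∀`-window membership — the typed residue of the `(Z)`-cell.

References: R. Courant, D. Hilbert, Methods of Mathematical Physics I, §I.4; file 1 and the cell files it cites.
-/

set_option linter.dupNamespace false

noncomputable section

open Real Set Matrix

namespace Summit.RiemannHypothesis.RiemannHypothesis.Theorems.PfPersistence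

/-! ## §1 Unit-amplitude binders at one window: every amplitude above the arrival floor is rejected -/

/-- **PROVED — UP-DIALS: EVERY AMPLITUDE ABOVE THE ARRIVAL FLOOR IS REJECTED.** At a window `w` reaching `q`,
BINDERS: a plane `{x, y}` (nonzero, orthogonal) of `ζ`-height `≤ η₂`, `η₂ ≥ 0`, on which the pattern satisfies
`−vᵀΘ_q v ≤ c′ vᵀv`, `c′ ≥ 0`; a vector `v₀ ≠ 0` of `ζ`-height `≤ η` with `vᵀ₀Θ_q v₀ ≥ ρ v₀ᵀv₀`. Then every dial
`K` with amplitude `t = 2(K − 1)w(q) > 0` and `t · (ρ(1 − τ) − τc′) > τη₂ + η(1 − τ)` (`0 ≤ τ < 1`) is NOT in the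
gauge-ratio conjunct at `w`. [folklore] -/
theorem dial_not_mem_gaugeRatioAt_of_amplitude {q : ℕ} {win : Window} (hq : q ∈ primeRange (2 * win.a))
    {x y : Fin (win.N + 1) → ℝ} (hx : x ≠ 0) (hy : y ≠ 0) (hxy : y ⬝ᵥ x = 0) {η₂ c' : ℝ} (hη₂ : 0 ≤ η₂)
    (hc' : 0 ≤ c')
    (hZ : ∀ α β : ℝ, (α • x + β • y) ⬝ᵥ (zetaDatum win *ᵥ (α • x + β • y))
      ≤ η₂ * ((α • x + β • y) ⬝ᵥ (α • x + β • y)))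
    (hΘ : ∀ α β : ℝ, -((α • x + β • y) ⬝ᵥ (primePattern q win *ᵥ (α • x + β • y)))
      ≤ c' * ((α • x + β • y) ⬝ᵥ (α • x + β • y)))
    {v₀ : Fin (win.N + 1) → ℝ} (hv₀ : v₀ ≠ 0) {η ρ : ℝ}
    (hZv : v₀ ⬝ᵥ (zetaDatum win *ᵥ v₀) ≤ η * (v₀ ⬝ᵥ v₀))
    (hρ : ρ * (v₀ ⬝ᵥ v₀) ≤ v₀ ⬝ᵥ (primePattern q win *ᵥ v₀))
    {τ : ℝ} (hτ0 : 0 ≤ τ) (hτ : τ < 1) {K : ℝ} (ht : 0 < 2 * (K - 1) * zetaWeights q)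
    (hamp : τ * η₂ + η * (1 - τ) < 2 * (K - 1) * zetaWeights q * (ρ * (1 - τ) - τ * c')) :
    datumOf (dial q K zetaWeights) ∉ gaugeRatioAt τ win := by
  set t : ℝ := 2 * (K - 1) * zetaWeights q with ht_def
  have hvv : 0 ≤ v₀ ⬝ᵥ v₀ := dotProduct_self_nonneg_real v₀
  -- `η < tρ`: from the amplitude inequality, `η₂, c′ ≥ 0` and `1 − τ > 0`
  have hηp : η < t * ρ := by
    have h1 : 0 ≤ τ * η₂ := mul_nonneg hτ0 hη₂
    have h2 : 0 ≤ t * (τ * c') := mul_nonneg ht.le (mul_nonneg hτ0 hc')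
    nlinarith
  refine dial_not_mem_gaugeRatioAt hq hx hy hxy hZ (c := t * c') ?_ hv₀ hηp hZv (p := t * ρ) ?_ hτ0 hτ ?_
  · intro α β
    have := mul_le_mul_of_nonneg_left (hΘ α β) ht.le
    nlinarith
  · have := mul_le_mul_of_nonneg_left hρ ht.le
    nlinarith
  · nlinarith

/-- **PROVED — DOWN-DIALS (mirror).** Binders: the plane as before with `vᵀΘ_q v ≤ c′ vᵀv` (`c′ ≥ 0`); `v₀ ≠ 0` of
`ζ`-height `≤ η` with `v₀ᵀΘ_q v₀ ≤ −ρ v₀ᵀv₀`. Then every dial with amplitude `t = 2(K − 1)w(q) < 0` and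
`(−t) · (ρ(1 − τ) − τc′) > τη₂ + η(1 − τ)` is NOT in the gauge-ratio conjunct at `w`. [folklore] -/
theorem dial_not_mem_gaugeRatioAt_of_amplitude_neg {q : ℕ} {win : Window} (hq : q ∈ primeRange (2 * win.a))
    {x y : Fin (win.N + 1) → ℝ} (hx : x ≠ 0) (hy : y ≠ 0) (hxy : y ⬝ᵥ x = 0) {η₂ c' : ℝ} (hη₂ : 0 ≤ η₂)
    (hc' : 0 ≤ c')
    (hZ : ∀ α β : ℝ, (α • x + β • y) ⬝ᵥ (zetaDatum win *ᵥ (α • x + β • y))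
      ≤ η₂ * ((α • x + β • y) ⬝ᵥ (α • x + β • y)))
    (hΘ : ∀ α β : ℝ, (α • x + β • y) ⬝ᵥ (primePattern q win *ᵥ (α • x + β • y))
      ≤ c' * ((α • x + β • y) ⬝ᵥ (α • x + β • y)))
    {v₀ : Fin (win.N + 1) → ℝ} (hv₀ : v₀ ≠ 0) {η ρ : ℝ}
    (hZv : v₀ ⬝ᵥ (zetaDatum win *ᵥ v₀) ≤ η * (v₀ ⬝ᵥ v₀))
    (hρ : v₀ ⬝ᵥ (primePattern q win *ᵥ v₀) ≤ -ρ * (v₀ ⬝ᵥ v₀))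
    {τ : ℝ} (hτ0 : 0 ≤ τ) (hτ : τ < 1) {K : ℝ} (ht : 2 * (K - 1) * zetaWeights q < 0)
    (hamp : τ * η₂ + η * (1 - τ) < -(2 * (K - 1) * zetaWeights q) * (ρ * (1 - τ) - τ * c')) :
    datumOf (dial q K zetaWeights) ∉ gaugeRatioAt τ win := by
  set t : ℝ := 2 * (K - 1) * zetaWeights q with ht_def
  have hvv : 0 ≤ v₀ ⬝ᵥ v₀ := dotProduct_self_nonneg_real v₀
  have hs : 0 < -t := neg_pos.2 ht
  have hηp : η < -t * ρ := by
    have h1 : 0 ≤ τ * η₂ := mul_nonneg hτ0 hη₂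
    have h2 : 0 ≤ -t * (τ * c') := mul_nonneg hs.le (mul_nonneg hτ0 hc')
    nlinarith
  refine dial_not_mem_gaugeRatioAt hq hx hy hxy hZ (c := -t * c') ?_ hv₀ hηp hZv (p := -t * ρ) ?_ hτ0 hτ ?_
  · intro α β
    have := mul_le_mul_of_nonneg_left (hΘ α β) hs.le
    nlinarith
  · have := mul_le_mul_of_nonneg_left hρ hs.le
    nlinarith
  · nlinarith

/-! ## §2 Binders along a window sequence; dial isolation AS WORDED -/

/-- the UP-DIAL CLUSTER BINDERS at the prime power `q` ALONG A WINDOW SEQUENCE `W : ℕ → Window` with pattern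
floor `ρ` and pattern cap `C` (a TYPED hypothesis package — per-window numbers are engine-certifiable; that they hold
along the far windows is DATA of record PF-N2 / PF-C7, NOT claimed): every `W n` reaches `q`, and for every `δ > 0`
SOME window of the sequence carries a plane `{x, y}` of `ζ`-height `≤ δ` on which `−vᵀΘ_q v ≤ C vᵀv` together
with a vector `v₀ ≠ 0` of `ζ`-height `≤ δ` and pattern value `≥ ρ`. [folklore] -/
structure ClusterBinders (q : ℕ) (W : ℕ → Window) (ρ C : ℝ) : Prop where
  reaches : ∀ n, q ∈ primeRange (2 * (W n).a)
  cap_nonneg : 0 ≤ C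
  small : ∀ δ : ℝ, 0 < δ → ∃ (n : ℕ) (x y v₀ : Fin ((W n).N + 1) → ℝ), x ≠ 0 ∧ y ≠ 0 ∧ y ⬝ᵥ x = 0 ∧ v₀ ≠ 0 ∧
    (∀ α β : ℝ, (α • x + β • y) ⬝ᵥ (zetaDatum (W n) *ᵥ (α • x + β • y))
      ≤ δ * ((α • x + β • y) ⬝ᵥ (α • x + β • y))) ∧
    (∀ α β : ℝ, -((α • x + β • y) ⬝ᵥ (primePattern q (W n) *ᵥ (α • x + β • y)))
      ≤ C * ((α • x + β • y) ⬝ᵥ (α • x + β • y))) ∧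
    v₀ ⬝ᵥ (zetaDatum (W n) *ᵥ v₀) ≤ δ * (v₀ ⬝ᵥ v₀) ∧
    ρ * (v₀ ⬝ᵥ v₀) ≤ v₀ ⬝ᵥ (primePattern q (W n) *ᵥ v₀)

/-- the DOWN-DIAL CLUSTER BINDERS (mirror): cap `vᵀΘ_q v ≤ C vᵀv` on the low plane and pattern value `≤ −ρ` on the
low vector. [folklore] -/
structure ClusterBindersNeg (q : ℕ) (W : ℕ → Window) (ρ C : ℝ) : Prop where
  reaches : ∀ n, q ∈ primeRange (2 * (W n).a)
  cap_nonneg : 0 ≤ C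
  small : ∀ δ : ℝ, 0 < δ → ∃ (n : ℕ) (x y v₀ : Fin ((W n).N + 1) → ℝ), x ≠ 0 ∧ y ≠ 0 ∧ y ⬝ᵥ x = 0 ∧ v₀ ≠ 0 ∧
    (∀ α β : ℝ, (α • x + β • y) ⬝ᵥ (zetaDatum (W n) *ᵥ (α • x + β • y))
      ≤ δ * ((α • x + β • y) ⬝ᵥ (α • x + β • y))) ∧
    (∀ α β : ℝ, (α • x + β • y) ⬝ᵥ (primePattern q (W n) *ᵥ (α • x + β • y))
      ≤ C * ((α • x + β • y) ⬝ᵥ (α • x + β • y))) ∧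
    v₀ ⬝ᵥ (zetaDatum (W n) *ᵥ v₀) ≤ δ * (v₀ ⬝ᵥ v₀) ∧
    v₀ ⬝ᵥ (primePattern q (W n) *ᵥ v₀) ≤ -ρ * (v₀ ⬝ᵥ v₀)

/-- **PROVED — EVERY UP-DIAL AMPLITUDE IS REJECTED AT SOME WINDOW OF THE SEQUENCE.** Under `ClusterBinders q W ρ C`
with `τC < ρ(1 − τ)` (`0 ≤ τ < 1`), every dial `K` with `t = 2(K − 1)w(q) > 0` fails the gauge-ratio conjunct at
some `W n` (take `δ = t(ρ(1 − τ) − τC)/2`: the arrival floor at a `δ`-low window is below `t`). [folklore] -/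
theorem exists_upDial_not_mem_gaugeRatioAt {q : ℕ} {W : ℕ → Window} {ρ C : ℝ} (hB : ClusterBinders q W ρ C)
    {τ : ℝ} (hτ0 : 0 ≤ τ) (hτ : τ < 1) (hρ : τ * C < ρ * (1 - τ)) {K : ℝ} (ht : 0 < 2 * (K - 1) * zetaWeights q) :
    ∃ n, datumOf (dial q K zetaWeights) ∉ gaugeRatioAt τ (W n) := by
  set t : ℝ := 2 * (K - 1) * zetaWeights q with ht_def
  have hgap : 0 < ρ * (1 - τ) - τ * C := by linarith
  obtain ⟨n, x, y, v₀, hx, hy, hxy, hv₀, hZ, hΘ, hZv, hρv⟩ :=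
    hB.small (t * (ρ * (1 - τ) - τ * C) / 2) (by positivity)
  refine ⟨n, dial_not_mem_gaugeRatioAt_of_amplitude (hB.reaches n) hx hy hxy (by positivity) hB.cap_nonneg hZ hΘ
    hv₀ hZv hρv hτ0 hτ ht ?_⟩
  have : τ * (t * (ρ * (1 - τ) - τ * C) / 2) + t * (ρ * (1 - τ) - τ * C) / 2 * (1 - τ)
      = t * (ρ * (1 - τ) - τ * C) / 2 := by ring
  rw [this]
  have hpos : 0 < t * (ρ * (1 - τ) - τ * C) := mul_pos ht hgap
  linarith

/-- **PROVED — DIAL ISOLATION OF `ζ`, AS WORDED (up-dials).** Under `ClusterBinders q W ρ C` with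
`τC < ρ(1 − τ)`, `0 ≤ τ < 1`: NO up-dial of `ζ` at `q`, of ANY amplitude `t = 2(K − 1)w(q) > 0`, lies in the
`∀`-window gauge-ratio class `GaugeRatioClass τ`. The W2 door of the `(Z)`-cell (small negative dials inside the
class) is closed at every binder-ready prime power; what the class does AS WORDED rests on `ζ`'s own `∀`-window
membership alone. [folklore] -/
theorem upDial_not_mem_gaugeRatioClass {q : ℕ} {W : ℕ → Window} {ρ C : ℝ} (hB : ClusterBinders q W ρ C)
    {τ : ℝ} (hτ0 : 0 ≤ τ) (hτ : τ < 1) (hρ : τ * C < ρ * (1 - τ)) {K : ℝ} (ht : 0 < 2 * (K - 1) * zetaWeights q) :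
    datumOf (dial q K zetaWeights) ∉ GaugeRatioClass τ := by
  obtain ⟨n, hn⟩ := exists_upDial_not_mem_gaugeRatioAt hB hτ0 hτ hρ ht
  exact fun h => hn (h (W n))

/-- **PROVED — mirror: EVERY DOWN-DIAL AMPLITUDE IS REJECTED AT SOME WINDOW** under `ClusterBindersNeg`.
[folklore] -/
theorem exists_downDial_not_mem_gaugeRatioAt {q : ℕ} {W : ℕ → Window} {ρ C : ℝ} (hB : ClusterBindersNeg q W ρ C)
    {τ : ℝ} (hτ0 : 0 ≤ τ) (hτ : τ < 1) (hρ : τ * C < ρ * (1 - τ)) {K : ℝ} (ht : 2 * (K - 1) * zetaWeights q < 0) :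
    ∃ n, datumOf (dial q K zetaWeights) ∉ gaugeRatioAt τ (W n) := by
  set t : ℝ := 2 * (K - 1) * zetaWeights q with ht_def
  have hgap : 0 < ρ * (1 - τ) - τ * C := by linarith
  have hs : 0 < -t := neg_pos.2 ht
  obtain ⟨n, x, y, v₀, hx, hy, hxy, hv₀, hZ, hΘ, hZv, hρv⟩ :=
    hB.small (-t * (ρ * (1 - τ) - τ * C) / 2) (by positivity)
  refine ⟨n, dial_not_mem_gaugeRatioAt_of_amplitude_neg (hB.reaches n) hx hy hxy (by positivity) hB.cap_nonneg hZ
    hΘ hv₀ hZv hρv hτ0 hτ ht ?_⟩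
  have : τ * (-t * (ρ * (1 - τ) - τ * C) / 2) + -t * (ρ * (1 - τ) - τ * C) / 2 * (1 - τ)
      = -t * (ρ * (1 - τ) - τ * C) / 2 := by ring
  rw [this]
  have hpos : 0 < -t * (ρ * (1 - τ) - τ * C) := mul_pos hs hgap
  linarith

/-- **PROVED — DIAL ISOLATION, AS WORDED (down-dials)** under `ClusterBindersNeg q W ρ C`, `τC < ρ(1 − τ)`.
[folklore] -/
theorem downDial_not_mem_gaugeRatioClass {q : ℕ} {W : ℕ → Window} {ρ C : ℝ} (hB : ClusterBindersNeg q W ρ C)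
    {τ : ℝ} (hτ0 : 0 ≤ τ) (hτ : τ < 1) (hρ : τ * C < ρ * (1 - τ)) {K : ℝ} (ht : 2 * (K - 1) * zetaWeights q < 0) :
    datumOf (dial q K zetaWeights) ∉ GaugeRatioClass τ := by
  obtain ⟨n, hn⟩ := exists_downDial_not_mem_gaugeRatioAt hB hτ0 hτ hρ ht
  exact fun h => hn (h (W n))

/-- **PROVED — BOTH SIGNS: under both binder packages the ONLY `q`-dial of `ζ` that can lie in the `∀`-window
gauge-ratio class is the trivial one** (`(K − 1)w(q) = 0`, i.e. the datum `ζ` itself when `w(q) ≠ 0`). [folklore] -/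
theorem dial_mem_gaugeRatioClass_imp_trivial {q : ℕ} {W : ℕ → Window} {ρ C ρ' C' : ℝ}
    (hB : ClusterBinders q W ρ C) (hB' : ClusterBindersNeg q W ρ' C') {τ : ℝ} (hτ0 : 0 ≤ τ) (hτ : τ < 1)
    (hρ : τ * C < ρ * (1 - τ)) (hρ' : τ * C' < ρ' * (1 - τ)) {K : ℝ}
    (hmem : datumOf (dial q K zetaWeights) ∈ GaugeRatioClass τ) : (K - 1) * zetaWeights q = 0 := by
  by_contra h
  rcases lt_or_gt_of_ne h with hlt | hgt
  · exact downDial_not_mem_gaugeRatioClass hB' hτ0 hτ hρ' (K := K) (by linarith) hmem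
  · exact upDial_not_mem_gaugeRatioClass hB hτ0 hτ hρ (K := K) (by linarith) hmem

/-! ## §3 For the carver: classes inside the `∀`-window conjunct contain no dial at a binder-ready prime power -/

/-- **PROVED — the `(Z)`-cell AS WORDED, dial part.** A class `S ⊆ GaugeRatioClass τ` (`0 ≤ τ < 1`) contains NO
up-dial of `ζ` at a prime power `q` carrying `ClusterBinders q W ρ C` with `τC < ρ(1 − τ)` — whatever the
amplitude, negative or not. Every such dial is an ARITHMETIC member (`datumOf_dial_zeta_mem_arithDialSpace`), so
on the tally domain the separating power of `S` at `q` owes nothing to small dials and everything to `ζ`'s own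
`∀`-window membership `∀ w, |ε₁(ζ; w)| ≤ τ·(ε₂ − ε₁)(ζ; w)` — the typed residue of the cell. [folklore] -/
theorem subset_gaugeRatioClass_disjoint_upDials {S : Set Datum} {τ : ℝ} (hS : S ⊆ GaugeRatioClass τ)
    (hτ0 : 0 ≤ τ) (hτ : τ < 1) {q : ℕ} {W : ℕ → Window} {ρ C : ℝ} (hB : ClusterBinders q W ρ C)
    (hρ : τ * C < ρ * (1 - τ)) {K : ℝ} (ht : 0 < 2 * (K - 1) * zetaWeights q) :
    datumOf (dial q K zetaWeights) ∈ arithDialSpace ∧ datumOf (dial q K zetaWeights) ∉ S :=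
  ⟨datumOf_dial_zeta_mem_arithDialSpace q K, fun h => upDial_not_mem_gaugeRatioClass hB hτ0 hτ hρ ht (hS h)⟩

/-- **PROVED — if such a class DOES separate `ζ` on a domain, it is not because of the dials:** `Separates S D ζ`
with `S ⊆ GaugeRatioClass τ` entails `ζ ∈ GaugeRatioClass τ`, i.e. the `∀`-window self-ratio bound
`|ε₁(ζ; w)| ≤ τ·(ε₂ − ε₁)(ζ; w)` at EVERY window — the statement the cell leaves standing (sign-blind; no claim
about its truth is made here). [folklore] -/
theorem zeta_mem_gaugeRatioClass_of_separates {S D : Set Datum} {τ : ℝ} (hS : S ⊆ GaugeRatioClass τ)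
    (hsep : Separates S D zetaDatum) : ∀ win, |bottomRayleigh (zetaDatum win)| ≤ τ * bottomGapGauge zetaDatum win :=
  fun win => hS hsep.1 win

end Summit.RiemannHypothesis.RiemannHypothesis.Theorems.PfPersistence

end
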